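import Summits.Parity.BatemanHorn.Theorems.SoloInformedSystemMoebiusDecay
import Summits.Parity.BatemanHorn.Theorems.SoloInformedLogMomentAbelian
import Literature.NumberTheory.LFunctions.PolynomialRootMoebiusRieszMeanConstant

/-!
# SoloInformedMoebiusLogMomentLimit — `∑_{n ≤ N} μ(n) ω_f(n) log^k n / n → (-1)^k k! C(f)`

Solo unit `solo-Parity-informed` (ideation tier, informed mode), session 17; `PLAN.md` §25.3, CLAIMS C87.

For every Bateman–Horn system `f` of `k ≥ 1` polynomials the `k`-th logarithmic moment of the
Möbius root-count harmonic series converges, and its limit is `(-1)^k k! C(f)` where `C(f)` is the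
Bateman–Horn constant (`tendsto_moebiusSysRootCount_logMoment`).  This is hypothesis `(H_k)` of the
`k`-dimensional localisation of the Bateman–Horn conjecture, now unconditional:

* existence of the limit: log-power decay of `∑_{n ≤ N} μ(n) ω_f(n)/n`
  (`SoloInformedSystemMoebiusDecay`) and partial summation (`SoloInformedLogMomentConvergence`);
* identification: the finite-difference Abelian argument of `SoloInformedLogMomentAbelian` with the
  Dirichlet series `D(u) = ∑ μ(n) ω_f(n) n^{-1-u}`, whose behaviour `D(u) ~ C(f) u^k` as `u → 0⁺`
  is `Literature…tendsto_moebiusRootCountSys_mul_zetaReal_pow` (Bateman–Horn 1962, §2 (2))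
  together with `(s-1)ζ(s) → 1`.
-/

namespace Summit.Parity.BatemanHorn.Theorems

open Finset Filter Real ArithmeticFunction Polynomial
open scoped Topology Nat ArithmeticFunction.Moebius
open Literature.NumberTheory.Sieve (polyRootCountMod IsBatemanHornSystem batemanHornConst)
open Literature.NumberTheory.LFunctions (polyRootCountModSys_mul_of_coprime sys_rootCount_le
  tendsto_moebiusRootCountSys_mul_zetaReal_pow tendsto_sub_one_mul_zetaReal)
open Literature.NumberTheory.GaloisRepresentations (summable_norm_of_summable_norm_prime_pow
  prod_tsum_norm_prime_pow_le_exp)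

variable {ι : Type*} [Fintype ι]

/-! ### Absolute convergence of `∑ μ(n) ω_f(n) n^{-s}` for `s > 1` -/

/-- `∑_n |μ(n)| ω_f(n) n^{-s} < ∞` for `s > 1` (Euler product with factors `1 + ω_f(p) p^{-s}`,
`ω_f(p) ≤ ∑ deg fᵢ`). -/
theorem summable_abs_moebius_sysRootCount_rpow {f : ι → ℤ[X]} (hf : IsBatemanHornSystem f)
    {s : ℝ} (hs : 1 < s) :
    Summable fun n : ℕ => |(μ n : ℝ)| * (polyRootCountMod f n : ℝ) * (n : ℝ) ^ (-s) := by
  set D : ℝ := ((∑ i, (f i).natDegree : ℕ) : ℝ) with hD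
  set F : ℕ → ℂ := fun n =>
    (((μ n : ℝ) * (polyRootCountMod f n : ℝ) * (n : ℝ) ^ (-s) : ℝ) : ℂ) with hFdef
  have hnF : ∀ n : ℕ, ‖F n‖ = |(μ n : ℝ)| * (polyRootCountMod f n : ℝ) * (n : ℝ) ^ (-s) := by
    intro n
    simp only [hFdef, Complex.norm_real, Real.norm_eq_abs, abs_mul, Nat.abs_cast,
      abs_of_nonneg (Real.rpow_nonneg (Nat.cast_nonneg n) _)]
  have hF1 : F 1 = 1 := by
    simp [hFdef, polyRootCountMod_sys_one]
  have hFmul : ∀ {m n : ℕ}, m.Coprime n → F (m * n) = F m * F n := by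
    intro m n hmn
    simp only [hFdef]
    rw [ArithmeticFunction.isMultiplicative_moebius.map_mul_of_coprime hmn,
      polyRootCountModSys_mul_of_coprime f hmn, Nat.cast_mul, Nat.cast_mul, Int.cast_mul,
      Real.mul_rpow (Nat.cast_nonneg _) (Nat.cast_nonneg _)]
    push_cast
    ring
  -- prime powers: only `k = 0, 1` contribute
  have hFpk : ∀ p k : ℕ, p.Prime → 2 ≤ k → F (p ^ k) = 0 := by
    intro p k hp hk
    simp only [hFdef]
    rw [ArithmeticFunction.moebius_apply_prime_pow hp (by omega), if_neg (by omega)]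
    simp
  have hFp : ∀ p : ℕ, p.Prime → ‖F p‖ = (polyRootCountMod f p : ℝ) * (p : ℝ) ^ (-s) := by
    intro p hp
    rw [hnF, ArithmeticFunction.moebius_apply_prime hp]
    simp
  set t : Nat.Primes → ℝ := fun p => D * ((p : ℕ) : ℝ) ^ (-s) with ht
  have ht0 : ∀ p, 0 ≤ t p := fun p => by positivity
  have htsum : Summable t := (Nat.Primes.summable_rpow.mpr (by linarith)).mul_left D
  have hloc : ∀ p : ℕ, p.Prime → (Summable fun k : ℕ => ‖F (p ^ k)‖) ∧
      ∑' k : ℕ, ‖F (p ^ k)‖ = 1 + (polyRootCountMod f p : ℝ) * (p : ℝ) ^ (-s) := by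
    intro p hp
    have hzero : ∀ k ∉ ({0, 1} : Finset ℕ), ‖F (p ^ k)‖ = 0 := by
      intro k hk
      have hk2 : 2 ≤ k := by
        simp only [Finset.mem_insert, Finset.mem_singleton] at hk
        omega
      rw [hFpk p k hp hk2, norm_zero]
    refine ⟨summable_of_ne_finset_zero hzero, ?_⟩
    rw [tsum_eq_sum hzero, Finset.sum_pair (by norm_num), pow_zero, pow_one, hF1, norm_one, hFp p hp]
  have hle : ∀ p : Nat.Primes, ∑' k : ℕ, ‖F ((p : ℕ) ^ k)‖ ≤ 1 + t p := by
    intro p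
    rw [(hloc p p.prop).2]
    simp only [ht]
    have := sys_rootCount_le hf p.prop
    gcongr
  have hsum := summable_norm_of_summable_norm_prime_pow hF1 hFmul (fun hp => (hloc _ hp).1)
    (prod_tsum_norm_prime_pow_le_exp ht0 htsum hle)
  exact hsum.congr hnF

/-- The partial sums `∑_{n ≤ N} (μ(n) ω_f(n)/n) n^{-u}` converge to the Dirichlet series
`∑_n μ(n) ω_f(n) n^{-(1+u)}` for `u > 0`. -/
theorem tendsto_sum_moebius_sysRootCount_div_mul_rpow {f : ι → ℤ[X]} (hf : IsBatemanHornSystem f)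
    {u : ℝ} (hu : 0 < u) :
    Tendsto (fun N : ℕ => ∑ n ∈ Icc 1 N,
        (μ n : ℝ) * (polyRootCountMod f n : ℝ) / n * (n : ℝ) ^ (-u)) atTop
      (𝓝 (∑' n : ℕ, (μ n : ℝ) * (polyRootCountMod f n : ℝ) * (n : ℝ) ^ (-(1 + u)))) := by
  set g : ℕ → ℝ := fun n => (μ n : ℝ) * (polyRootCountMod f n : ℝ) * (n : ℝ) ^ (-(1 + u))
    with hgdef
  have hgs : Summable g := by
    refine Summable.of_norm_bounded (summable_abs_moebius_sysRootCount_rpow hf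
      (s := 1 + u) (by linarith)) fun n => ?_
    simp only [hgdef, Real.norm_eq_abs, abs_mul, Nat.abs_cast,
      abs_of_nonneg (Real.rpow_nonneg (Nat.cast_nonneg n) _)]
    exact le_rfl
  have hg0 : g 0 = 0 := by simp [hgdef]
  have hident : ∀ N : ℕ, ∑ n ∈ Icc 1 N,
      (μ n : ℝ) * (polyRootCountMod f n : ℝ) / n * (n : ℝ) ^ (-u) =
        ∑ n ∈ Finset.range (N + 1), g n := by
    intro N
    rw [Finset.range_eq_Ico, Finset.sum_eq_sum_Ico_succ_bot (Nat.succ_pos N), hg0, zero_add]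
    have hI : Finset.Ico (0 + 1) N.succ = Icc 1 N := by
      rw [zero_add, Nat.succ_eq_add_one, Finset.Ico_add_one_right_eq_Icc]
    rw [hI]
    refine sum_congr rfl fun n hn => ?_
    rw [mem_Icc] at hn
    have hn0 : (0 : ℝ) < n := by exact_mod_cast hn.1
    simp only [hgdef]
    rw [show -(1 + u) = (-1 : ℝ) + -u by ring, Real.rpow_add hn0, Real.rpow_neg_one]
    ring
  simp_rw [hident]
  exact hgs.hasSum.tendsto_sum_nat.comp (tendsto_add_atTop_nat 1)

/-- `D(1+u)/u^k → C(f)` as `u → 0⁺`, where `D(s) = ∑ μ(n) ω_f(n) n^{-s}` and `k = card ι`: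
from `D(s) ζ(s)^k → C(f)` and `(s-1)ζ(s) → 1`. -/
theorem tendsto_moebiusSysRootCount_dirichlet_div_pow {f : ι → ℤ[X]} (hf : IsBatemanHornSystem f) :
    Tendsto (fun u : ℝ => (∑' n : ℕ, (μ n : ℝ) * (polyRootCountMod f n : ℝ) *
        (n : ℝ) ^ (-(1 + u))) / u ^ Fintype.card ι) (𝓝[>] 0) (𝓝 (batemanHornConst f)) := by
  set k := Fintype.card ι with hk
  set Φ : ℝ → ℝ := fun s => ∑' n : ℕ, (μ n : ℝ) * (polyRootCountMod f n : ℝ) * (n : ℝ) ^ (-s)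
    with hΦ
  set Z : ℝ → ℝ := fun s => ∑' n : ℕ, (n : ℝ) ^ (-s) with hZ
  have h1 : Tendsto (fun s : ℝ => Φ s * Z s ^ k) (𝓝[>] 1) (𝓝 (batemanHornConst f)) :=
    tendsto_moebiusRootCountSys_mul_zetaReal_pow hf
  have h2 : Tendsto (fun s : ℝ => (s - 1) * Z s) (𝓝[>] 1) (𝓝 1) := tendsto_sub_one_mul_zetaReal
  have h3 : Tendsto (fun s : ℝ => Φ s * Z s ^ k / ((s - 1) * Z s) ^ k) (𝓝[>] 1)
      (𝓝 (batemanHornConst f / 1 ^ k)) := h1.div (h2.pow k) (by simp)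
  rw [one_pow, div_one] at h3
  have hne : ∀ᶠ s : ℝ in 𝓝[>] 1, (s - 1) * Z s ≠ 0 := h2.eventually_ne one_ne_zero
  have h4 : Tendsto (fun s : ℝ => Φ s / (s - 1) ^ k) (𝓝[>] 1) (𝓝 (batemanHornConst f)) := by
    refine h3.congr' ?_
    filter_upwards [hne] with s hs
    have hZ0 : Z s ≠ 0 := fun h => hs (by rw [h, mul_zero])
    rw [mul_pow, mul_div_mul_right _ _ (pow_ne_zero _ hZ0)]
  have hmap : Tendsto (fun u : ℝ => 1 + u) (𝓝[>] 0) (𝓝[>] 1) := by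
    refine tendsto_nhdsWithin_iff.mpr ⟨?_, ?_⟩
    · have : Tendsto (fun u : ℝ => 1 + u) (𝓝 0) (𝓝 (1 + 0)) :=
        ((continuous_const.add continuous_id).tendsto 0)
      rw [add_zero] at this
      exact this.mono_left nhdsWithin_le_nhds
    · filter_upwards [self_mem_nhdsWithin] with u (hu : 0 < u)
      simp only [Set.mem_Ioi]
      linarith
  refine (h4.comp hmap).congr fun u => ?_
  simp only [Function.comp, hΦ, add_sub_cancel_left]

/-- **`(H_k)` for every Bateman–Horn system.**  For a Bateman–Horn system `f` of `k ≥ 1`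
polynomials, `∑_{n ≤ N} μ(n) ω_f(n) log^k n / n → (-1)^k k! C(f)` as `N → ∞`, where `C(f)` is
the Bateman–Horn constant. -/
theorem tendsto_moebiusSysRootCount_logMoment {f : ι → ℤ[X]} (hf : IsBatemanHornSystem f)
    (hk : 0 < Fintype.card ι) :
    Tendsto (fun N : ℕ => ∑ n ∈ Icc 1 N,
        (μ n : ℝ) * (polyRootCountMod f n : ℝ) / n * Real.log n ^ Fintype.card ι) atTop
      (𝓝 ((-1) ^ Fintype.card ι * (Fintype.card ι)! * batemanHornConst f)) := by
  obtain ⟨C, hC⟩ := sys_moebiusRootCount_div_logPowDecay hf hk (Fintype.card ι + 2)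
  obtain ⟨A, hA⟩ := exists_tendsto_sum_mul_log_pow_of_decay
    (c := fun n => (μ n : ℝ) * (polyRootCountMod f n : ℝ) / n) (j := Fintype.card ι) hC
  have hAeq := logPowSum_limit_eq_of_dirichletSeries hk hA
    (D := fun u => ∑' n : ℕ, (μ n : ℝ) * (polyRootCountMod f n : ℝ) * (n : ℝ) ^ (-(1 + u)))
    (fun u hu => tendsto_sum_moebius_sysRootCount_div_mul_rpow hf hu)
    (tendsto_moebiusSysRootCount_dirichlet_div_pow hf)
  rw [← hAeq]
  exact hA

end Summit.Parity.BatemanHorn.Theorems
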